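import Summits.CriticalPhenomena.PercolationContinuityZ3.Theorems.PercNearOneGluingNoHeavyLowerTailSunflowerPureClasses
import Summits.CriticalPhenomena.PercolationContinuityZ3.Theorems.PercNearOneGluingNoHeavyLowerTailSunflowerLinkedCurrencyVoluntary
import HarnessLib

/-!
# `NoHeavyLowerTail` (crux stmt-CriticalPhenomena-4575), abstract sunflower cubic: (RES0′) for every number of petals on
# the class "`h`-floor petals ∪ pure `h`-petals", on an explicit parameter region

Support file (seat `prim-ineq-prove-1` gen 60; `--supports stmt-CriticalPhenomena-4575`).  No `sorry`, no named facts.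
Memo: run/shared/lean/prim/prim-ineq-prove-1/FINDING-HFACE-prove1-g60.md §6.  (`set_option maxHeartbeats 400000`: one long model proof; the algebra is factored into the `hfhp_*` identities.)

Two-linked-systems model (`…SunflowerLinkedCurrency`): coins `τ, σ, s`, floors `α₀₀ ≤ α₀₁ ≤ α₁₁`, petals `(y,k,g,h)`,
`Ȳ = (1−s)y + sk`, `H = (1−σ)g + σh`, `G = c₀ + τ(1−σ)Ȳ + s(1−τ)H`, `g* = G(floor)`, `a = G(full)`; budgets here: the two
FACES `(BȲ) ∏Ȳ_j ≤ b_Ȳ^(n−1)`, `(BH) ∏H_j ≤ b_H^(n−1)` and the `h`-CELL `(Bh) ∏h_j ≤ α₁₁^(n−1)`.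

**`res0_hfloor_hpetals`.**  Every family each of whose petals is either `h`-FLOOR (`h_j = α₁₁`, with the link `g_j ≤ k_j`;
x-hubs, k-hubs, cheap-`y` petals, leverage dwarfs up to `α₁₁`, …) or a pure `h`-PETAL (`y_j = α₀₀, k_j = g_j = α₀₁`) satisfies
`∏ G_j ≤ (g*)^(n−1)·a` for every `n`, provided the floor masses satisfy gen 52's `(1−σ)b_Ȳ ≤ g*`, `s b_H ≤ g*` and the ONE
extra condition `τ((1−σ)α₀₁ + σ − b_Ȳ) ≤ c₀(1−α₀₁)`, i.e. `τ(1−s)(α₀₁−α₀₀) ≤ (c₀ − τσ)(1−α₀₁)`: the excess of the constant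
over `τσ` pays for one cheap-`y` capacity `c* = τ(1−σ)(1−s)(α₀₁−α₀₀)/g*` (automatic at `s = 1` or `α₀₀ = α₀₁`; with the
leaf-leaf constant `c₀ = τσ + (1−s)(1−τ)α₀₀` it is the region `α₀₀ ≥ τα₀₁/(1 − (1−τ)α₀₁)`).  This extends `res0_hfloor`
(no `h`-petals) and `res0_pure` (gen 60; `h`-floor replaced by `H`-floor) to the first class containing BOTH leverage dwarfs
and full `h`-petals.
PROOF.  Class 1 by gen 52's budget-free `linked_two_currency` (`∏ ≤ 1 + ε_Y(X₁−1) + ε_H(𝒴₁−1)` in its ACTUAL face usages,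
link `τb ≤ (1−τ)a` from `g ≤ k`); class 2 by one coin on the `H`-face (`∏ ≤ 1 + ε_H(𝒴₂−1)`) and by one coin on the `h`-cell
(`ε_H(𝒴₂−1) ≤ E* = ε_h(1/α₁₁−1)`); `(BH)` couples `𝒴₁𝒴₂ ≤ 1/b_H`; the endgame `(1+A₁+B₁)(1+B₂) ≤ T` (`hpetal_endgame`) is a
convex quadratic in `B₂` vanishing at `B₂ = 0`, so it reduces to its value at `B₂ = E*`, which is the extra condition.
WHY A REGION: the class-1 bound allows `(A₁,𝒴₁) = (all Ȳ, all H-residual)`, which no real `h`-floor family attains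
(`Ȳ`-concentration forces `g ≤ α₁₁`); closing the gap `τ(1−s)(α₀₁−α₀₀)` for all parameters needs the joint `(Ȳ,H)`-usage
region of `h`-floor families (memo §4(c)(i)). [this work]
-/

noncomputable section

namespace Summit.CriticalPhenomena.PercolationContinuityZ3.Theorems.SunflowerPartition

namespace SafeCalc

namespace LinkedCurrency

open Finset

variable {κ : Type*}

/-! ## Small algebraic identities (kept out of the main proof's large context) -/

/-- `1 + (c u/g)/(c d/g) = (d + u)/d`. [this work] -/
theorem hfhp_one_add_ratio {c u g d : ℝ} (hc : c ≠ 0) (hg : g ≠ 0) (hd : d ≠ 0) :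
    1 + c * u / g / (c * d / g) = (d + u) / d := by
  field_simp

/-- `(p b/g)(1/b − 1) = p(1 − b)/g`. [this work] -/
theorem hfhp_excess_cap {p b g : ℝ} (hb : b ≠ 0) (hg : g ≠ 0) :
    p * b / g * (1 / b - 1) = p * (1 - b) / g := by
  field_simp

/-- `(q b_H/g)·((σα₁₁/b_H)(1/α₁₁ − 1)) = qσ(1 − α₁₁)/g`. [this work] -/
theorem hfhp_hcap {q bH g σ α11 : ℝ} (hbH : bH ≠ 0) (hg : g ≠ 0) (hα : α11 ≠ 0) :
    q * bH / g * (σ * α11 / bH * (1 / α11 - 1)) = q * σ * (1 - α11) / g := by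
  field_simp

/-- `ε_H(ε_H + q(1−b_H)/g) = ε_H² / b_H` for `ε_H = q b_H/g`. [this work] -/
theorem hfhp_Hcap {q bH g : ℝ} (hbH : bH ≠ 0) (hg : g ≠ 0) :
    q * bH / g * (q * bH / g + q * (1 - bH) / g) = q * bH / g * (q * bH / g) * (1 / bH) := by
  field_simp
  ring

/-- The endgame slack identity: with `g = c₀ + p b_Ȳ + q b_H`, `R_Y = p(1−b_Ȳ)/g`, `R_H = q(1−b_H)/g`,
`E* = qσ(1−α₁₁)/g`, `ε_H = q b_H/g`:
`(1+R_Y+R_H) − ((1+R_Y−ε_H)(1+ε_H+E*) + ε_H(ε_H+R_H)) = q·((c₀ + p b_Ȳ) − (c₀+p)(b_H + σ(1−α₁₁)))/g²`. [this work] -/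
theorem hfhp_slack_identity {c0 p q bY bH σ α11 g : ℝ} (hg : g = c0 + p * bY + q * bH) (hgne : g ≠ 0) :
    (1 + p * (1 - bY) / g + q * (1 - bH) / g) -
        ((1 + p * (1 - bY) / g - q * bH / g) * (1 + q * bH / g + q * σ * (1 - α11) / g) +
          q * bH / g * (q * bH / g + q * (1 - bH) / g)) =
      q * ((c0 + p * bY) - (c0 + p) * (bH + σ * (1 - α11))) / g ^ 2 := by
  field_simp
  rw [hg]
  ring

/-- `g(1 + R_Y + R_H) = c₀ + p + q`. [this work] -/
theorem hfhp_total {c0 p q bY bH g : ℝ} (hg : g = c0 + p * bY + q * bH) (hgne : g ≠ 0) :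
    g * (1 + p * (1 - bY) / g + q * (1 - bH) / g) = c0 + p + q := by
  field_simp
  rw [hg]
  ring

/-- `((1−σ)α₀₁ + σx)/b_H = 1 + (σα₁₁/b_H)(x/α₁₁ − 1)` for `b_H = (1−σ)α₀₁ + σα₁₁`. [this work] -/
theorem hfhp_hpetal_usage {σ α01 α11 bH x : ℝ} (hbH : bH = (1 - σ) * α01 + σ * α11) (hbH0 : bH ≠ 0)
    (hα : α11 ≠ 0) : ((1 - σ) * α01 + σ * x) / bH = 1 + σ * α11 / bH * (x / α11 - 1) := by
  rw [eq_comm, ← sub_eq_zero]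
  field_simp
  rw [hbH]
  ring

/-- **The `h`-petal endgame.**  `ε_H > 0`; a class with face excesses `A₁ ≤ R_Y`, `B₁` and an `h`-petal class with
`0 ≤ B₂ ≤ E*`, coupled by the `H`-face `(ε_H + B₁)(ε_H + B₂) ≤ ε_H(ε_H + R_H)`; if `1 + R_Y ≥ ε_H` and the value at
`B₂ = E*` is admissible, `(1 + R_Y − ε_H)(1 + ε_H + E*) + ε_H(ε_H + R_H) ≤ 1 + R_Y + R_H`, then
`(1 + A₁ + B₁)(1 + B₂) ≤ 1 + R_Y + R_H` (convexity in `B₂`). [this work] -/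
theorem hpetal_endgame {RY RH εH Es A1 B1 B2 : ℝ} (hεH : 0 < εH) (hA : A1 ≤ RY) (hB2 : 0 ≤ B2)
    (hB2E : B2 ≤ Es) (hC1 : 0 ≤ 1 + RY - εH) (hH : (εH + B1) * (εH + B2) ≤ εH * (εH + RH))
    (hcond : (1 + RY - εH) * (1 + εH + Es) + εH * (εH + RH) ≤ 1 + RY + RH) :
    (1 + A1 + B1) * (1 + B2) ≤ 1 + RY + RH := by
  have hpos : 0 < εH + B2 := by linarith
  have h1 : (1 + A1 + B1) * (1 + B2) ≤ (1 + RY + B1) * (1 + B2) :=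
    mul_le_mul_of_nonneg_right (by linarith) (by linarith)
  -- (1 + RY + B1)(εH + B2) ≤ (1 + RY − εH)(εH + B2) + εH(εH + RH)
  have h2 : (1 + RY + B1) * (εH + B2) ≤ (1 + RY - εH) * (εH + B2) + εH * (εH + RH) := by nlinarith
  -- the convex quadratic: (1+B2)[(1+RY−εH)(εH+B2) + εH(εH+RH)] − (1+RY+RH)(εH+B2) = B2·(C1 B2 + κ₀) ≤ 0
  have h3 : (1 + RY - εH) * B2 + ((1 + RY - εH) * (1 + εH) + εH * (εH + RH) - (1 + RY + RH)) ≤ 0 := by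
    nlinarith [mul_le_mul_of_nonneg_left hB2E hC1]
  have h4 : (1 + B2) * ((1 + RY - εH) * (εH + B2) + εH * (εH + RH)) ≤ (1 + RY + RH) * (εH + B2) := by
    have e : (1 + RY + RH) * (εH + B2) - (1 + B2) * ((1 + RY - εH) * (εH + B2) + εH * (εH + RH)) =
        B2 * (-((1 + RY - εH) * B2 + ((1 + RY - εH) * (1 + εH) + εH * (εH + RH) - (1 + RY + RH)))) := by ring
    nlinarith [mul_nonneg hB2 (neg_nonneg.2 h3)]
  have h5 : (1 + RY + B1) * (1 + B2) * (εH + B2) ≤ (1 + RY + RH) * (εH + B2) := by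
    calc (1 + RY + B1) * (1 + B2) * (εH + B2) = (1 + B2) * ((1 + RY + B1) * (εH + B2)) := by ring
      _ ≤ (1 + B2) * ((1 + RY - εH) * (εH + B2) + εH * (εH + RH)) :=
          mul_le_mul_of_nonneg_left h2 (by linarith)
      _ ≤ (1 + RY + RH) * (εH + B2) := h4
  have h6 : (1 + RY + B1) * (1 + B2) ≤ 1 + RY + RH := le_of_mul_le_mul_right h5 hpos
  exact h1.trans h6

set_option maxHeartbeats 400000 in
/-- **(RES0′) ∀n ON `h`-FLOOR FAMILIES WITH `h`-PETALS, explicit region.**  Coins `0 < τ < 1`, `0 < σ < 1`, `0 < s ≤ 1`;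
floors `0 < α₀₀ ≤ α₀₁ ≤ α₁₁ ≤ 1`; constant `c₀ ≥ 0` with `(1−σ)b_Ȳ ≤ g*`, `s b_H ≤ g*` (gen 52's floor-mass conditions) and
`τ((1−σ)α₀₁ + σ − b_Ȳ) ≤ c₀(1−α₀₁)`.  Petals `j ∈ S` with `α₀₀ ≤ y_j`, `α₀₁ ≤ k_j`, `α₀₁ ≤ g_j`, `α₁₁ ≤ h_j`, each either
`h`-floor with the link `g ≤ k` (`h_j = α₁₁ ∧ g_j ≤ k_j`) or a pure `h`-petal (`y_j = α₀₀ ∧ k_j = α₀₁ ∧ g_j = α₀₁`).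
Budgets `(BȲ)`, `(BH)`, `(Bh)`.  Then `∏ G_j ≤ (g*)^(|S|−1)·a`. [this work] -/
theorem res0_hfloor_hpetals [DecidableEq κ] {τ σ s α00 α01 α11 c0 : ℝ} (hτ0 : 0 < τ) (hτ1 : τ < 1) (hσ0 : 0 < σ)
    (hσ1 : σ < 1) (hs0 : 0 < s) (hs1 : s ≤ 1) (hα0 : 0 < α00) (h01 : α00 ≤ α01) (h11 : α01 ≤ α11) (hα1 : α11 ≤ 1)
    (hc0 : 0 ≤ c0)
    (hεY : (1 - σ) * ((1 - s) * α00 + s * α01) ≤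
      c0 + τ * (1 - σ) * ((1 - s) * α00 + s * α01) + s * (1 - τ) * ((1 - σ) * α01 + σ * α11))
    (hεH : s * ((1 - σ) * α01 + σ * α11) ≤
      c0 + τ * (1 - σ) * ((1 - s) * α00 + s * α01) + s * (1 - τ) * ((1 - σ) * α01 + σ * α11))
    (hcond : τ * ((1 - σ) * α01 + σ - ((1 - s) * α00 + s * α01)) ≤ c0 * (1 - α01))
    (S : Finset κ) (hS : S.Nonempty) (y k gc h : κ → ℝ)
    (hy : ∀ j ∈ S, α00 ≤ y j) (hk : ∀ j ∈ S, α01 ≤ k j) (hg : ∀ j ∈ S, α01 ≤ gc j) (hh : ∀ j ∈ S, α11 ≤ h j)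
    (hcl : ∀ j ∈ S, (h j = α11 ∧ gc j ≤ k j) ∨ (y j = α00 ∧ k j = α01 ∧ gc j = α01))
    (hBY : ∏ j ∈ S, ((1 - s) * y j + s * k j) ≤ ((1 - s) * α00 + s * α01) ^ (S.card - 1))
    (hBH : ∏ j ∈ S, ((1 - σ) * gc j + σ * h j) ≤ ((1 - σ) * α01 + σ * α11) ^ (S.card - 1))
    (hBh : ∏ j ∈ S, h j ≤ α11 ^ (S.card - 1)) :
    ∏ j ∈ S, (c0 + τ * (1 - σ) * ((1 - s) * y j + s * k j) + s * (1 - τ) * ((1 - σ) * gc j + σ * h j)) ≤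
      (c0 + τ * (1 - σ) * ((1 - s) * α00 + s * α01) + s * (1 - τ) * ((1 - σ) * α01 + σ * α11)) ^ (S.card - 1) *
        (c0 + τ * (1 - σ) + s * (1 - τ)) := by
  have hτ1' : 0 < 1 - τ := sub_pos.2 hτ1
  have hσ1' : 0 < 1 - σ := sub_pos.2 hσ1
  have hs1' : 0 ≤ 1 - s := sub_nonneg.2 hs1
  have hα01 : 0 < α01 := lt_of_lt_of_le hα0 h01
  have hα11 : 0 < α11 := lt_of_lt_of_le hα01 h11
  obtain ⟨p, hp⟩ : ∃ e : ℝ, e = τ * (1 - σ) := ⟨_, rfl⟩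
  obtain ⟨q, hq⟩ : ∃ e : ℝ, e = s * (1 - τ) := ⟨_, rfl⟩
  simp only [← hp, ← hq] at hεY hεH ⊢
  have hp0 : 0 < p := by rw [hp]; exact mul_pos hτ0 hσ1'
  have hq0 : 0 < q := by rw [hq]; exact mul_pos hs0 hτ1'
  obtain ⟨bY, hbY⟩ : ∃ e : ℝ, e = (1 - s) * α00 + s * α01 := ⟨_, rfl⟩
  obtain ⟨bH, hbH⟩ : ∃ e : ℝ, e = (1 - σ) * α01 + σ * α11 := ⟨_, rfl⟩
  rw [← hbY] at hBY hεY hεH hcond ⊢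
  rw [← hbH] at hBH hεY hεH ⊢
  have hbY0 : 0 < bY := by rw [hbY]; nlinarith [mul_nonneg hs1' hα0.le, mul_pos hs0 hα01]
  have hbY1 : bY ≤ 1 := by rw [hbY]; nlinarith [h01, h11, hα1]
  have hbH0 : 0 < bH := by rw [hbH]; nlinarith [mul_pos hσ1' hα01, mul_nonneg hσ0.le hα11.le]
  have hbH1 : bH ≤ 1 := by rw [hbH]; nlinarith
  have hσbH : σ * α11 ≤ bH := by rw [hbH]; nlinarith [mul_pos hσ1' hα01]
  -- the floor value g* and the two face masses
  obtain ⟨g, hgdef⟩ : ∃ e : ℝ, e = c0 + p * bY + q * bH := ⟨_, rfl⟩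
  rw [← hgdef] at hεY hεH ⊢
  have hgpos : 0 < g := by rw [hgdef]; nlinarith [mul_pos hp0 hbY0, mul_pos hq0 hbH0]
  have hgne : g ≠ 0 := hgpos.ne'
  obtain ⟨εY, hεYd⟩ : ∃ e : ℝ, e = p * bY / g := ⟨_, rfl⟩
  obtain ⟨εH, hεHd⟩ : ∃ e : ℝ, e = q * bH / g := ⟨_, rfl⟩
  have hεY0 : 0 < εY := by rw [hεYd]; exact div_pos (mul_pos hp0 hbY0) hgpos
  have hεH0 : 0 < εH := by rw [hεHd]; exact div_pos (mul_pos hq0 hbH0) hgpos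
  have hεYτ : εY ≤ τ := by
    rw [hεYd, div_le_iff₀ hgpos, hp]
    have := mul_le_mul_of_nonneg_left hεY hτ0.le
    linarith
  have hεHτ : εH ≤ 1 - τ := by
    rw [hεHd, div_le_iff₀ hgpos, hq]
    have := mul_le_mul_of_nonneg_left hεH hτ1'.le
    linarith
  have hεH1 : εH ≤ 1 := by linarith
  -- the two classes: S2 = pure h-petals, S1 = the rest (h-floor, g ≤ k)
  obtain ⟨S2, hS2⟩ : ∃ T : Finset κ, T = S.filter (fun j => y j = α00 ∧ k j = α01 ∧ gc j = α01) := ⟨_, rfl⟩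
  obtain ⟨S1, hS1⟩ : ∃ T : Finset κ, T = S.filter (fun j => ¬ (y j = α00 ∧ k j = α01 ∧ gc j = α01)) := ⟨_, rfl⟩
  have hS12 : ∀ f : κ → ℝ, ∏ j ∈ S, f j = (∏ j ∈ S1, f j) * ∏ j ∈ S2, f j := fun f => by
    rw [hS1, hS2, mul_comm]; exact (prod_filter_mul_prod_filter_not S _ f).symm
  have hcard12 : S1.card + S2.card = S.card := by
    rw [hS1, hS2, add_comm]; exact Finset.card_filter_add_card_filter_not _
  have hS1sub : S1 ⊆ S := by rw [hS1]; exact filter_subset _ _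
  have hS2sub : S2 ⊆ S := by rw [hS2]; exact filter_subset _ _
  have hS2p : ∀ j ∈ S2, y j = α00 ∧ k j = α01 ∧ gc j = α01 := fun j hj => by
    rw [hS2] at hj; exact (mem_filter.1 hj).2
  have hS1p : ∀ j ∈ S1, h j = α11 ∧ gc j ≤ k j := fun j hj => by
    rw [hS1] at hj
    have h1 := mem_filter.1 hj
    rcases hcl j h1.1 with h2 | h2
    · exact h2
    · exact absurd h2 h1.2
  -- class-1 excesses: a_j = p(Ȳ_j − bY)/g (Ȳ face), b_j = q(1−σ)(g_j − α01)/g (H face, h at floor)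
  obtain ⟨a, ha⟩ : ∃ f : κ → ℝ, f = fun j => p * ((1 - s) * y j + s * k j - bY) / g := ⟨_, rfl⟩
  have haj : ∀ j, a j = p * ((1 - s) * y j + s * k j - bY) / g := fun j => by rw [ha]
  obtain ⟨b, hb⟩ : ∃ f : κ → ℝ, f = fun j => q * ((1 - σ) * (gc j - α01)) / g := ⟨_, rfl⟩
  have hbj : ∀ j, b j = q * ((1 - σ) * (gc j - α01)) / g := fun j => by rw [hb]
  have hYge : ∀ j ∈ S, bY ≤ (1 - s) * y j + s * k j := fun j hj => by
    rw [hbY]; nlinarith [mul_le_mul_of_nonneg_left (hy j hj) hs1', mul_le_mul_of_nonneg_left (hk j hj) hs0.le]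
  have ha0 : ∀ j ∈ S1, 0 ≤ a j := fun j hj => by
    rw [haj]; exact div_nonneg (mul_nonneg hp0.le (sub_nonneg.2 (hYge j (hS1sub hj)))) hgpos.le
  have hb0 : ∀ j ∈ S1, 0 ≤ b j := fun j hj => by
    rw [hbj]; exact div_nonneg (mul_nonneg hq0.le (mul_nonneg hσ1'.le (sub_nonneg.2 (hg j (hS1sub hj))))) hgpos.le
  have hlink : ∀ j ∈ S1, τ * b j ≤ (1 - τ) * a j := fun j hj => by
    rw [haj, hbj, hp, hq]
    rw [mul_div_assoc', mul_div_assoc', div_le_div_iff_of_pos_right hgpos]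
    have h1 : s * (gc j - α01) ≤ (1 - s) * y j + s * k j - bY := by
      rw [hbY]
      have t1 := mul_le_mul_of_nonneg_left (hS1p j hj).2 hs0.le
      have t2 := mul_le_mul_of_nonneg_left (hy j (hS1sub hj)) hs1'
      linarith
    have h2 : 0 ≤ τ * (1 - τ) * (1 - σ) := mul_nonneg (mul_nonneg hτ0.le hτ1'.le) hσ1'.le
    have h3 := mul_le_mul_of_nonneg_left h1 h2
    have e1 : τ * (s * (1 - τ) * ((1 - σ) * (gc j - α01))) = τ * (1 - τ) * (1 - σ) * (s * (gc j - α01)) := by ring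
    have e2 : (1 - τ) * (τ * (1 - σ) * ((1 - s) * y j + s * k j - bY)) =
        τ * (1 - τ) * (1 - σ) * ((1 - s) * y j + s * k j - bY) := by ring
    rw [e1, e2]; exact h3
  have main1 := linked_two_currency hτ0 hτ1 hεY0 hεYτ hεH0 hεHτ a b S1 hb0 hlink
  -- class-2 excess e_j = qσ(h_j − α11)/g with 1 + e_j/εH = H_j/bH
  obtain ⟨e, he⟩ : ∃ f : κ → ℝ, f = fun j => q * σ * (h j - α11) / g := ⟨_, rfl⟩
  have hej : ∀ j, e j = q * σ * (h j - α11) / g := fun j => by rw [he]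
  have he0 : ∀ j ∈ S2, 0 ≤ e j := fun j hj => by
    rw [hej]; exact div_nonneg (mul_nonneg (mul_nonneg hq0.le hσ0.le) (sub_nonneg.2 (hh j (hS2sub hj)))) hgpos.le
  -- factorisations of G_j
  have hG1 : ∀ j ∈ S1, c0 + p * ((1 - s) * y j + s * k j) + q * ((1 - σ) * gc j + σ * h j) =
      g * (1 + a j + b j) := by
    intro j hj
    have e1 : g * a j = p * ((1 - s) * y j + s * k j - bY) := by rw [haj]; field_simp
    have e2 : g * b j = q * ((1 - σ) * (gc j - α01)) := by rw [hbj]; field_simp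
    rw [(hS1p j hj).1]
    linear_combination (-1 : ℝ) * e1 - e2 - hgdef - q * hbH
  have hG2 : ∀ j ∈ S2, c0 + p * ((1 - s) * y j + s * k j) + q * ((1 - σ) * gc j + σ * h j) = g * (1 + e j) := by
    intro j hj
    obtain ⟨hy2, hk2, hg2⟩ := hS2p j hj
    have e1 : g * e j = q * σ * (h j - α11) := by rw [hej]; field_simp
    rw [hy2, hk2, hg2]
    linear_combination (-1 : ℝ) * e1 - hgdef - q * hbH - p * hbY
  -- face usages
  have hcard : 1 ≤ S.card := card_pos.2 hS
  -- Ȳ face: X1 = ∏_{S1}(1 + a/εY) = ∏_S Ȳ/bY ≤ 1/bY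
  have hratioY : ∏ j ∈ S, (((1 - s) * y j + s * k j) / bY) ≤ 1 / bY := by
    rw [prod_div_distrib, prod_const, div_le_div_iff₀ (pow_pos hbY0 _) hbY0, one_mul,
      show bY ^ S.card = bY ^ (S.card - 1) * bY by
        conv_lhs => rw [show S.card = (S.card - 1) + 1 by omega, pow_succ]]
    exact mul_le_mul_of_nonneg_right hBY hbY0.le
  have hX1 : ∏ j ∈ S1, (1 + a j / εY) ≤ 1 / bY := by
    have e1 : ∀ j ∈ S1, 1 + a j / εY = ((1 - s) * y j + s * k j) / bY := fun j _ => by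
      rw [haj, hεYd, hfhp_one_add_ratio hp0.ne' hgne hbY0.ne']
      congr 1; ring
    rw [prod_congr rfl e1]
    have e2 : ∏ j ∈ S2, (((1 - s) * y j + s * k j) / bY) = 1 := by
      refine prod_eq_one fun j hj => ?_
      obtain ⟨hy2, hk2, _⟩ := hS2p j hj
      rw [hy2, hk2, ← hbY, div_self hbY0.ne']
    have e3 := hS12 (fun j => ((1 - s) * y j + s * k j) / bY)
    rw [e2, mul_one] at e3
    rw [← e3]; exact hratioY
  -- H face: 𝒴1 = ∏_{S1}(1 + b/εH), 𝒴2 = ∏_{S2}(1 + e/εH); (BH) gives 𝒴1 𝒴2 ≤ 1/bH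
  have hratioH : ∏ j ∈ S, (((1 - σ) * gc j + σ * h j) / bH) ≤ 1 / bH := by
    rw [prod_div_distrib, prod_const, div_le_div_iff₀ (pow_pos hbH0 _) hbH0, one_mul,
      show bH ^ S.card = bH ^ (S.card - 1) * bH by
        conv_lhs => rw [show S.card = (S.card - 1) + 1 by omega, pow_succ]]
    exact mul_le_mul_of_nonneg_right hBH hbH0.le
  have hY1 : ∀ j ∈ S1, 1 + b j / εH = ((1 - σ) * gc j + σ * h j) / bH := fun j hj => by
    rw [hbj, hεHd, (hS1p j hj).1, hfhp_one_add_ratio hq0.ne' hgne hbH0.ne']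
    congr 1; rw [hbH]; ring
  have hY2 : ∀ j ∈ S2, 1 + e j / εH = ((1 - σ) * gc j + σ * h j) / bH := fun j hj => by
    rw [hej, hεHd, (hS2p j hj).2.2, show q * σ * (h j - α11) = q * (σ * (h j - α11)) by ring,
      hfhp_one_add_ratio hq0.ne' hgne hbH0.ne']
    congr 1; rw [hbH]; ring
  have hY12 : (∏ j ∈ S1, (1 + b j / εH)) * ∏ j ∈ S2, (1 + e j / εH) ≤ 1 / bH := by
    rw [prod_congr rfl hY1, prod_congr rfl hY2, ← hS12]; exact hratioH
  -- h cell: 𝒴2 ≤ 1 + λ_h(1/α11 − 1) with λ_h = σα11/bH ≤ 1 (one coin), hence B2 ≤ E*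
  obtain ⟨lh, hlh⟩ : ∃ v : ℝ, v = σ * α11 / bH := ⟨_, rfl⟩
  have hlh0 : 0 < lh := by rw [hlh]; exact div_pos (mul_pos hσ0 hα11) hbH0
  have hlh1 : lh ≤ 1 := by rw [hlh, div_le_one hbH0]; exact hσbH
  obtain ⟨w, hw⟩ : ∃ f : κ → ℝ, f = fun j => lh * (h j / α11 - 1) := ⟨_, rfl⟩
  have hwj : ∀ j, w j = lh * (h j / α11 - 1) := fun j => by rw [hw]
  have hw0 : ∀ j ∈ S2, 0 ≤ w j := fun j hj => by
    rw [hwj]; exact mul_nonneg hlh0.le (by rw [sub_nonneg, le_div_iff₀ hα11, one_mul]; exact hh j (hS2sub hj))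
  have hratioh : ∏ j ∈ S, (h j / α11) ≤ 1 / α11 := by
    rw [prod_div_distrib, prod_const, div_le_div_iff₀ (pow_pos hα11 _) hα11, one_mul,
      show α11 ^ S.card = α11 ^ (S.card - 1) * α11 by
        conv_lhs => rw [show S.card = (S.card - 1) + 1 by omega, pow_succ]]
    exact mul_le_mul_of_nonneg_right hBh hα11.le
  have hR2 : ∏ j ∈ S2, (1 + w j / lh) ≤ 1 / α11 := by
    have e1 : ∀ j ∈ S2, 1 + w j / lh = h j / α11 := fun j _ => by
      rw [hwj, mul_div_right_comm, div_self hlh0.ne', one_mul]; ring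
    rw [prod_congr rfl e1]
    have e2 : ∏ j ∈ S1, (h j / α11) = 1 := prod_eq_one fun j hj => by rw [(hS1p j hj).1, div_self hα11.ne']
    have e3 := hS12 (fun j => h j / α11)
    rw [e2, one_mul] at e3
    rw [← e3]; exact hratioh
  have hY2w : ∀ j ∈ S2, 1 + e j / εH = 1 + w j := fun j hj => by
    rw [hY2 j hj, hwj, hlh, (hS2p j hj).2.2]; exact hfhp_hpetal_usage hbH hbH0.ne' hα11.ne'
  have hY2le : ∏ j ∈ S2, (1 + e j / εH) ≤ 1 + lh * (1 / α11 - 1) := by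
    rw [prod_congr rfl hY2w]; exact one_coin_class S2 w hw0 hlh0 hlh1 hR2
  -- the three aggregate quantities
  obtain ⟨A1, hA1⟩ : ∃ v : ℝ, v = εY * (∏ j ∈ S1, (1 + a j / εY) - 1) := ⟨_, rfl⟩
  obtain ⟨B1, hB1⟩ : ∃ v : ℝ, v = εH * (∏ j ∈ S1, (1 + b j / εH) - 1) := ⟨_, rfl⟩
  obtain ⟨B2, hB2⟩ : ∃ v : ℝ, v = εH * (∏ j ∈ S2, (1 + e j / εH) - 1) := ⟨_, rfl⟩
  have hP1 : ∏ j ∈ S1, (1 + a j + b j) ≤ 1 + A1 + B1 := by rw [hA1, hB1]; linarith [main1]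
  have hP2 : ∏ j ∈ S2, (1 + e j) ≤ 1 + B2 := by
    rw [hB2]; exact one_coin_class S2 e he0 hεH0 hεH1 le_rfl
  have hprod1 : 1 ≤ ∏ j ∈ S1, (1 + b j / εH) :=
    one_le_prod_one_add_div hεH0 S1 b hb0
  have hprod2 : 1 ≤ ∏ j ∈ S2, (1 + e j / εH) :=
    one_le_prod_one_add_div hεH0 S2 e he0
  have hB1_0 : 0 ≤ B1 := by rw [hB1]; exact mul_nonneg hεH0.le (by linarith)
  have hB2_0 : 0 ≤ B2 := by rw [hB2]; exact mul_nonneg hεH0.le (by linarith)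
  have hA1le : A1 ≤ p * (1 - bY) / g := by
    rw [hA1]
    have h1 : εY * (∏ j ∈ S1, (1 + a j / εY) - 1) ≤ εY * (1 / bY - 1) :=
      mul_le_mul_of_nonneg_left (by linarith [hX1]) hεY0.le
    refine h1.trans (le_of_eq ?_)
    rw [hεYd]; exact hfhp_excess_cap hbY0.ne' hgne
  have hB2le : B2 ≤ q * σ * (1 - α11) / g := by
    rw [hB2]
    have h1 : εH * (∏ j ∈ S2, (1 + e j / εH) - 1) ≤ εH * (lh * (1 / α11 - 1)) :=
      mul_le_mul_of_nonneg_left (by linarith [hY2le]) hεH0.le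
    refine h1.trans (le_of_eq ?_)
    rw [hεHd, hlh]; exact hfhp_hcap hbH0.ne' hgne hα11.ne'
  have hHcouple : (εH + B1) * (εH + B2) ≤ εH * (εH + q * (1 - bH) / g) := by
    have e1 : εH + B1 = εH * ∏ j ∈ S1, (1 + b j / εH) := by rw [hB1]; ring
    have e2 : εH + B2 = εH * ∏ j ∈ S2, (1 + e j / εH) := by rw [hB2]; ring
    have e3 : εH * (εH + q * (1 - bH) / g) = εH * εH * (1 / bH) := by rw [hεHd]; exact hfhp_Hcap hbH0.ne' hgne
    rw [e1, e2, e3,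
      show εH * (∏ j ∈ S1, (1 + b j / εH)) * (εH * ∏ j ∈ S2, (1 + e j / εH)) =
        εH * εH * ((∏ j ∈ S1, (1 + b j / εH)) * ∏ j ∈ S2, (1 + e j / εH)) by ring]
    exact mul_le_mul_of_nonneg_left hY12 (mul_nonneg hεH0.le hεH0.le)
  -- the endgame, in the variables RY = p(1−bY)/g, RH = q(1−bH)/g, E* = qσ(1−α11)/g
  obtain ⟨RY, hRY⟩ : ∃ v : ℝ, v = p * (1 - bY) / g := ⟨_, rfl⟩
  obtain ⟨RH, hRH⟩ : ∃ v : ℝ, v = q * (1 - bH) / g := ⟨_, rfl⟩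
  obtain ⟨Es, hEs⟩ : ∃ v : ℝ, v = q * σ * (1 - α11) / g := ⟨_, rfl⟩
  rw [← hRY] at hA1le
  rw [← hEs] at hB2le
  rw [← hRH] at hHcouple
  have hRY0 : 0 ≤ RY := by rw [hRY]; exact div_nonneg (mul_nonneg hp0.le (by linarith)) hgpos.le
  have hC1 : 0 ≤ 1 + RY - εH := by linarith
  have hcondA : (1 + RY - εH) * (1 + εH + Es) + εH * (εH + RH) ≤ 1 + RY + RH := by
    have hD : (c0 + p) * (bH + σ * (1 - α11)) ≤ c0 + p * bY := by
      have e1 : bH + σ * (1 - α11) = (1 - σ) * α01 + σ := by rw [hbH]; ring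
      rw [e1, hp]
      have h1 := mul_le_mul_of_nonneg_left hcond hσ1'.le
      have e2 : (1 - σ) * (c0 * (1 - α01)) - (1 - σ) * (τ * ((1 - σ) * α01 + σ - bY)) =
          (c0 + τ * (1 - σ) * bY) - (c0 + τ * (1 - σ)) * ((1 - σ) * α01 + σ) := by ring
      linarith
    have key : (1 + RY + RH) - ((1 + RY - εH) * (1 + εH + Es) + εH * (εH + RH)) =
        q * ((c0 + p * bY) - (c0 + p) * (bH + σ * (1 - α11))) / g ^ 2 := by
      rw [hRY, hRH, hEs, hεHd]; exact hfhp_slack_identity hgdef hgne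
    have hnn : 0 ≤ q * ((c0 + p * bY) - (c0 + p) * (bH + σ * (1 - α11))) / g ^ 2 :=
      div_nonneg (mul_nonneg hq0.le (sub_nonneg.2 hD)) (by positivity)
    linarith
  have hend := hpetal_endgame hεH0 hA1le hB2_0 hB2le hC1 hHcouple hcondA
  -- assemble
  have hga : g * (1 + RY + RH) = c0 + p + q := by
    rw [hRY, hRH]; exact hfhp_total hgdef hgne
  rw [hS12, prod_congr rfl hG1, prod_congr rfl hG2, prod_const_mul', prod_const_mul']
  have hP1pos : 0 ≤ ∏ j ∈ S1, (1 + a j + b j) := prod_nonneg fun j hj => by linarith [ha0 j hj, hb0 j hj]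
  have hP2pos : 0 ≤ ∏ j ∈ S2, (1 + e j) := prod_nonneg fun j hj => by linarith [he0 j hj]
  have hprod : (∏ j ∈ S1, (1 + a j + b j)) * ∏ j ∈ S2, (1 + e j) ≤ (1 + A1 + B1) * (1 + B2) :=
    mul_le_mul hP1 hP2 hP2pos (by linarith [hP1pos.trans hP1])
  have hpow : g ^ S1.card * (∏ j ∈ S1, (1 + a j + b j)) * (g ^ S2.card * ∏ j ∈ S2, (1 + e j)) =
      g ^ (S.card - 1) * (g * ((∏ j ∈ S1, (1 + a j + b j)) * ∏ j ∈ S2, (1 + e j))) := by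
    have : g ^ S1.card * g ^ S2.card = g ^ (S.card - 1) * g := by
      rw [← pow_add, hcard12]
      conv_lhs => rw [show S.card = (S.card - 1) + 1 by omega, pow_succ]
    calc g ^ S1.card * (∏ j ∈ S1, (1 + a j + b j)) * (g ^ S2.card * ∏ j ∈ S2, (1 + e j))
        = (g ^ S1.card * g ^ S2.card) * ((∏ j ∈ S1, (1 + a j + b j)) * ∏ j ∈ S2, (1 + e j)) := by ring
      _ = _ := by rw [this]; ring
  rw [hpow, ← hga]
  refine mul_le_mul_of_nonneg_left ?_ (by positivity)
  calc g * ((∏ j ∈ S1, (1 + a j + b j)) * ∏ j ∈ S2, (1 + e j))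
      ≤ g * ((1 + A1 + B1) * (1 + B2)) := mul_le_mul_of_nonneg_left hprod hgpos.le
    _ ≤ g * (1 + RY + RH) := mul_le_mul_of_nonneg_left hend hgpos.le

end LinkedCurrency

end SafeCalc

end Summit.CriticalPhenomena.PercolationContinuityZ3.Theorems.SunflowerPartition
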